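import Literature.MathematicalPhysics.KineticTheory.LangevinChainLyapunovDrift
import HarnessLib

/-!
# Calculus rules for the SDE generator `L f = Df·Y + ½ ∑_b D²f[v_b, v_b]`

Trunk T-KINETIC (`Literature/MathematicalPhysics/KineticTheory`). Support file for the
formalisation of [HM09, Thm 5.6] (the Lyapunov function of the three-oscillator chain), whose
proof is a long computation with the generator of the Langevin dynamics applied to products,
sums and compositions ("Applying Itô's formula to …", [HM09, §4–§5]). For the generator
`sdeGenerator Y v₁ v₂` of `ConfinedGeneratorStep.lean` and GLOBALLY `C²` functions this file
proves: linearity (`sdeGenerator_add/sub/neg/const_mul/const/sum`), the value on continuous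
linear functionals (`sdeGenerator_clm`), the **product rule**
`L(fg) = f Lg + g Lf + Γ(f,g)` with the carré du champ
`Γ(f,g) = Df·v₁ Dg·v₁ + Df·v₂ Dg·v₂` (`sdeGenerator_mul`), and the **composition with a
continuous linear map** `L(g ∘ A)(y) = Dg(Ay)·A(Y y) + ½ ∑_b D²g(Ay)[Av_b, Av_b]`
(`sdeGenerator_comp_clm`; with `A v_b = 0` the second-order term drops,
`sdeGenerator_comp_clm_of_apply_eq_zero`). The scalar chain rule `L(F∘g)` is
`sdeGenerator_comp` (`LangevinChainLyapunovDrift.lean`). Everything is proved; no named facts.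

## References

* M. Hairer, J. C. Mattingly, *Slow energy dissipation in anharmonic oscillator chains*,
  Comm. Pure Appl. Math. **62** (2009), arXiv:0712.3884, §4–§5 (Itô computations).
  [cite: HairerMattingly2009, §4 and §5]
* D. Bakry, I. Gentil, M. Ledoux, *Analysis and Geometry of Markov Diffusion Operators* (2014),
  §1.4.2 (carré du champ, `L(fg) = fLg + gLf + 2Γ(f,g)`; here `Γ` absorbs the factor `2`).
-/

noncomputable section

open Set Filter Topology Function

namespace Literature.MathematicalPhysics.KineticTheory

variable {E : Type*} [NormedAddCommGroup E] [NormedSpace ℝ E]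
variable {F : Type*} [NormedAddCommGroup F] [NormedSpace ℝ F]

/-! ### Second derivatives of sums and products -/

section SecondDerivatives

variable {f g : E → ℝ}

/-- A `C²` function is differentiable. [folklore] -/
theorem differentiable_of_contDiff_two (hf : ContDiff ℝ 2 f) : Differentiable ℝ f :=
  hf.differentiable (by norm_num)

/-- The derivative of a `C²` function is differentiable. [folklore] -/
theorem differentiable_fderiv_of_contDiff_two (hf : ContDiff ℝ 2 f) : Differentiable ℝ (fderiv ℝ f) :=
  (hf.fderiv_right (m := 1) (by norm_num)).differentiable (by norm_num)

/-- `D(f + g) = Df + Dg` for `C²` functions (as functions). [folklore] -/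
theorem fderiv_add_eq (hf : ContDiff ℝ 2 f) (hg : ContDiff ℝ 2 g) :
    fderiv ℝ (f + g) = fderiv ℝ f + fderiv ℝ g :=
  funext fun y => fderiv_add (differentiable_of_contDiff_two hf y) (differentiable_of_contDiff_two hg y)

/-- `D²(f+g)[v,w] = D²f[v,w] + D²g[v,w]`. [folklore] -/
theorem fderiv_fderiv_add_apply (hf : ContDiff ℝ 2 f) (hg : ContDiff ℝ 2 g) (y v w : E) :
    fderiv ℝ (fderiv ℝ (f + g)) y v w =
      fderiv ℝ (fderiv ℝ f) y v w + fderiv ℝ (fderiv ℝ g) y v w := by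
  rw [fderiv_add_eq hf hg, fderiv_add (differentiable_fderiv_of_contDiff_two hf y)
    (differentiable_fderiv_of_contDiff_two hg y)]
  rfl

/-- `D(c f) = c Df` (as functions). [folklore] -/
theorem fderiv_const_mul_eq (hf : ContDiff ℝ 2 f) (c : ℝ) :
    fderiv ℝ (fun y => c * f y) = c • fderiv ℝ f :=
  funext fun y => by rw [Pi.smul_apply]; exact fderiv_const_mul (differentiable_of_contDiff_two hf y) c

/-- `D²(cf)[v,w] = c D²f[v,w]`. [folklore] -/
theorem fderiv_fderiv_const_mul_apply (hf : ContDiff ℝ 2 f) (c : ℝ) (y v w : E) :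
    fderiv ℝ (fderiv ℝ (fun y => c * f y)) y v w = c * fderiv ℝ (fderiv ℝ f) y v w := by
  rw [fderiv_const_mul_eq hf c, fderiv_const_smul (differentiable_fderiv_of_contDiff_two hf y) c]
  rfl

/-- `D(fg) = f Dg + g Df` (as functions). [folklore] -/
theorem fderiv_mul_eq (hf : ContDiff ℝ 2 f) (hg : ContDiff ℝ 2 g) :
    fderiv ℝ (f * g) = fun y => f y • fderiv ℝ g y + g y • fderiv ℝ f y :=
  funext fun y => fderiv_mul (differentiable_of_contDiff_two hf y) (differentiable_of_contDiff_two hg y)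

/-- The derivative of `y ↦ D(fg)(y) = f y • Dg y + g y • Df y`. [folklore] -/
theorem hasFDerivAt_fderiv_mul (hf : ContDiff ℝ 2 f) (hg : ContDiff ℝ 2 g) (y : E) :
    HasFDerivAt (fderiv ℝ (f * g))
      ((f y • fderiv ℝ (fderiv ℝ g) y + (fderiv ℝ f y).smulRight (fderiv ℝ g y)) +
        (g y • fderiv ℝ (fderiv ℝ f) y + (fderiv ℝ g y).smulRight (fderiv ℝ f y))) y := by
  rw [fderiv_mul_eq hf hg]
  have h1 : HasFDerivAt (fun y => f y • fderiv ℝ g y)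
      (f y • fderiv ℝ (fderiv ℝ g) y + (fderiv ℝ f y).smulRight (fderiv ℝ g y)) y :=
    (differentiable_of_contDiff_two hf y).hasFDerivAt.smul
      (differentiable_fderiv_of_contDiff_two hg y).hasFDerivAt
  have h2 : HasFDerivAt (fun y => g y • fderiv ℝ f y)
      (g y • fderiv ℝ (fderiv ℝ f) y + (fderiv ℝ g y).smulRight (fderiv ℝ f y)) y :=
    (differentiable_of_contDiff_two hg y).hasFDerivAt.smul
      (differentiable_fderiv_of_contDiff_two hf y).hasFDerivAt
  exact h1.add h2

/-- **Second derivative of a product along two vectors**: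
`D²(fg)[v,w] = f D²g[v,w] + g D²f[v,w] + Df·v Dg·w + Dg·v Df·w`. [folklore] -/
theorem fderiv_fderiv_mul_apply (hf : ContDiff ℝ 2 f) (hg : ContDiff ℝ 2 g) (y v w : E) :
    fderiv ℝ (fderiv ℝ (f * g)) y v w =
      f y * fderiv ℝ (fderiv ℝ g) y v w + g y * fderiv ℝ (fderiv ℝ f) y v w +
        (fderiv ℝ f y v * fderiv ℝ g y w + fderiv ℝ g y v * fderiv ℝ f y w) := by
  rw [(hasFDerivAt_fderiv_mul hf hg y).fderiv]
  simp only [add_apply, smul_apply, ContinuousLinearMap.smulRight_apply, smul_eq_mul]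
  ring

end SecondDerivatives

/-! ### Linearity of the generator -/

section Linearity

variable (Y : E → E) (v₁ v₂ : E) {f g : E → ℝ}

/-- `L` is additive on `C²` functions. [folklore] -/
theorem sdeGenerator_add (hf : ContDiff ℝ 2 f) (hg : ContDiff ℝ 2 g) (y : E) :
    sdeGenerator Y v₁ v₂ (f + g) y = sdeGenerator Y v₁ v₂ f y + sdeGenerator Y v₁ v₂ g y := by
  rw [sdeGenerator_def, sdeGenerator_def, sdeGenerator_def, fderiv_fderiv_add_apply hf hg,
    fderiv_fderiv_add_apply hf hg, fderiv_add_eq hf hg]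
  simp only [Pi.add_apply, add_apply]
  ring

/-- `L` is additive (lambda form). [folklore] -/
theorem sdeGenerator_add' (hf : ContDiff ℝ 2 f) (hg : ContDiff ℝ 2 g) (y : E) :
    sdeGenerator Y v₁ v₂ (fun y => f y + g y) y = sdeGenerator Y v₁ v₂ f y + sdeGenerator Y v₁ v₂ g y :=
  sdeGenerator_add Y v₁ v₂ hf hg y

/-- `L (c f) = c L f`. [folklore] -/
theorem sdeGenerator_const_mul (hf : ContDiff ℝ 2 f) (c : ℝ) (y : E) :
    sdeGenerator Y v₁ v₂ (fun y => c * f y) y = c * sdeGenerator Y v₁ v₂ f y := by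
  rw [sdeGenerator_def, sdeGenerator_def, fderiv_fderiv_const_mul_apply hf,
    fderiv_fderiv_const_mul_apply hf, fderiv_const_mul_eq hf]
  simp only [Pi.smul_apply, smul_apply, smul_eq_mul]
  ring

/-- `L (-f) = -L f`. [folklore] -/
theorem sdeGenerator_neg (hf : ContDiff ℝ 2 f) (y : E) :
    sdeGenerator Y v₁ v₂ (fun y => -f y) y = -sdeGenerator Y v₁ v₂ f y := by
  have := sdeGenerator_const_mul Y v₁ v₂ hf (-1) y
  simp only [neg_mul, one_mul] at this
  exact this

/-- `L (f - g) = L f - L g`. [folklore] -/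
theorem sdeGenerator_sub (hf : ContDiff ℝ 2 f) (hg : ContDiff ℝ 2 g) (y : E) :
    sdeGenerator Y v₁ v₂ (fun y => f y - g y) y = sdeGenerator Y v₁ v₂ f y - sdeGenerator Y v₁ v₂ g y := by
  have h := sdeGenerator_add' Y v₁ v₂ hf hg.neg y
  rw [sdeGenerator_neg Y v₁ v₂ hg] at h
  simpa [sub_eq_add_neg] using h

/-- `L c = 0` for a constant. [folklore] -/
theorem sdeGenerator_const (c : ℝ) (y : E) : sdeGenerator Y v₁ v₂ (fun _ => c) y = 0 := by
  simp [sdeGenerator_def]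

/-- `L (f + c) = L f`. [folklore] -/
theorem sdeGenerator_add_const (hf : ContDiff ℝ 2 f) (c : ℝ) (y : E) :
    sdeGenerator Y v₁ v₂ (fun y => f y + c) y = sdeGenerator Y v₁ v₂ f y := by
  rw [sdeGenerator_add' Y v₁ v₂ hf contDiff_const, sdeGenerator_const, add_zero]

/-- `L` of a finite sum of `C²` functions. [folklore] -/
theorem sdeGenerator_sum {ι : Type*} (s : Finset ι) {f : ι → E → ℝ} (hf : ∀ i ∈ s, ContDiff ℝ 2 (f i))
    (y : E) : sdeGenerator Y v₁ v₂ (fun y => ∑ i ∈ s, f i y) y = ∑ i ∈ s, sdeGenerator Y v₁ v₂ (f i) y := by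
  classical
  induction s using Finset.induction_on with
  | empty => simp [sdeGenerator_const]
  | insert a s ha ih =>
    have hfa : ContDiff ℝ 2 (f a) := hf a (Finset.mem_insert_self a s)
    have hfs : ∀ i ∈ s, ContDiff ℝ 2 (f i) := fun i hi => hf i (Finset.mem_insert_of_mem hi)
    have hsum : ContDiff ℝ 2 fun y => ∑ i ∈ s, f i y := ContDiff.sum fun i hi => hfs i hi
    simp only [Finset.sum_insert ha]
    rw [sdeGenerator_add' Y v₁ v₂ hfa hsum, ih hfs]

/-- **`L ℓ = ℓ(Y)` for a continuous linear functional** (its second derivative vanishes). [folklore] -/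
theorem sdeGenerator_clm (ℓ : E →L[ℝ] ℝ) (y : E) : sdeGenerator Y v₁ v₂ ℓ y = ℓ (Y y) := by
  rw [sdeGenerator_def, ℓ.fderiv]
  have : fderiv ℝ (fderiv ℝ (ℓ : E → ℝ)) y = 0 := by
    rw [show fderiv ℝ (ℓ : E → ℝ) = fun _ => ℓ from funext fun x => ℓ.fderiv]
    exact fderiv_const_apply _
  rw [this]
  simp

end Linearity

/-! ### The product rule and the carré du champ -/

section Product

variable (Y : E → E) (v₁ v₂ : E) {f g : E → ℝ}

/-- The carré du champ of the generator: `Γ(f,g)(y) = Df(y)·v₁ Dg(y)·v₁ + Df(y)·v₂ Dg(y)·v₂`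
(so that `L(fg) = f Lg + g Lf + Γ(f,g)`). [folklore] -/
def carreDuChamp (v₁ v₂ : E) (f g : E → ℝ) (y : E) : ℝ :=
  fderiv ℝ f y v₁ * fderiv ℝ g y v₁ + fderiv ℝ f y v₂ * fderiv ℝ g y v₂

/-- Unfolding lemma for the carré du champ. [folklore] -/
theorem carreDuChamp_def (f g : E → ℝ) (y : E) :
    carreDuChamp v₁ v₂ f g y = fderiv ℝ f y v₁ * fderiv ℝ g y v₁ + fderiv ℝ f y v₂ * fderiv ℝ g y v₂ := rfl

/-- The carré du champ is symmetric. [folklore] -/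
theorem carreDuChamp_comm (f g : E → ℝ) (y : E) : carreDuChamp v₁ v₂ f g y = carreDuChamp v₁ v₂ g f y := by
  simp only [carreDuChamp_def]; ring

/-- `Γ(f,f) = (Df·v₁)² + (Df·v₂)²`. [folklore] -/
theorem carreDuChamp_self (f : E → ℝ) (y : E) :
    carreDuChamp v₁ v₂ f f y = fderiv ℝ f y v₁ ^ 2 + fderiv ℝ f y v₂ ^ 2 := by
  simp only [carreDuChamp_def]; ring

/-- `Γ(f,f) ≥ 0`. [folklore] -/
theorem carreDuChamp_self_nonneg (f : E → ℝ) (y : E) : 0 ≤ carreDuChamp v₁ v₂ f f y := by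
  rw [carreDuChamp_self]; positivity

/-- `Γ(f,g) = 0` when `Dg` kills both noise directions. [folklore] -/
theorem carreDuChamp_eq_zero_of_right {f g : E → ℝ} {y : E} (h₁ : fderiv ℝ g y v₁ = 0)
    (h₂ : fderiv ℝ g y v₂ = 0) : carreDuChamp v₁ v₂ f g y = 0 := by
  simp [carreDuChamp_def, h₁, h₂]

/-- `Γ(f,g) = 0` when `Df` kills both noise directions. [folklore] -/
theorem carreDuChamp_eq_zero_of_left {f g : E → ℝ} {y : E} (h₁ : fderiv ℝ f y v₁ = 0)
    (h₂ : fderiv ℝ f y v₂ = 0) : carreDuChamp v₁ v₂ f g y = 0 := by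
  simp [carreDuChamp_def, h₁, h₂]

/-- Cauchy–Schwarz for the carré du champ: `|Γ(f,g)| ≤ (Γ(f,f) + Γ(g,g))/2`. [folklore] -/
theorem abs_carreDuChamp_le (f g : E → ℝ) (y : E) :
    |carreDuChamp v₁ v₂ f g y| ≤ (carreDuChamp v₁ v₂ f f y + carreDuChamp v₁ v₂ g g y) / 2 := by
  rw [carreDuChamp_self, carreDuChamp_self, carreDuChamp_def, abs_le]
  constructor <;> nlinarith [sq_nonneg (fderiv ℝ f y v₁ + fderiv ℝ g y v₁), sq_nonneg (fderiv ℝ f y v₂ + fderiv ℝ g y v₂),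
    sq_nonneg (fderiv ℝ f y v₁ - fderiv ℝ g y v₁), sq_nonneg (fderiv ℝ f y v₂ - fderiv ℝ g y v₂)]

/-- **The product rule** `L(fg) = f Lg + g Lf + Γ(f,g)` for `C²` functions. [cite: HairerMattingly2009, §5 (Itô's formula for products)] -/
theorem sdeGenerator_mul (hf : ContDiff ℝ 2 f) (hg : ContDiff ℝ 2 g) (y : E) :
    sdeGenerator Y v₁ v₂ (f * g) y =
      f y * sdeGenerator Y v₁ v₂ g y + g y * sdeGenerator Y v₁ v₂ f y + carreDuChamp v₁ v₂ f g y := by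
  rw [sdeGenerator_def, sdeGenerator_def, sdeGenerator_def, fderiv_fderiv_mul_apply hf hg,
    fderiv_fderiv_mul_apply hf hg, fderiv_mul_eq hf hg]
  simp only [add_apply, smul_apply, smul_eq_mul, carreDuChamp_def]
  ring

/-- The product rule (lambda form). [folklore] -/
theorem sdeGenerator_mul' (hf : ContDiff ℝ 2 f) (hg : ContDiff ℝ 2 g) (y : E) :
    sdeGenerator Y v₁ v₂ (fun y => f y * g y) y =
      f y * sdeGenerator Y v₁ v₂ g y + g y * sdeGenerator Y v₁ v₂ f y + carreDuChamp v₁ v₂ f g y :=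
  sdeGenerator_mul Y v₁ v₂ hf hg y

/-- `L(f²) = 2 f Lf + Γ(f,f)`. [folklore] -/
theorem sdeGenerator_sq (hf : ContDiff ℝ 2 f) (y : E) :
    sdeGenerator Y v₁ v₂ (fun y => f y ^ 2) y = 2 * f y * sdeGenerator Y v₁ v₂ f y + carreDuChamp v₁ v₂ f f y := by
  have := sdeGenerator_mul' Y v₁ v₂ hf hf y
  simp only [← sq] at this
  rw [this]; ring

/-- The scalar chain rule in carré-du-champ form: `L(F∘g) = F'(g) Lg + ½ F''(g) Γ(g,g)`.
[folklore] -/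
theorem sdeGenerator_comp_eq (Y : E → E) (v₁ v₂ : E) {F F' F'' : ℝ → ℝ} (hF : ∀ u, HasDerivAt F (F' u) u)
    (hF' : ∀ u, HasDerivAt F' (F'' u) u) {g : E → ℝ} (hg : ContDiff ℝ 2 g) (y : E) :
    sdeGenerator Y v₁ v₂ (fun y => F (g y)) y =
      F' (g y) * sdeGenerator Y v₁ v₂ g y + (1 / 2) * F'' (g y) * carreDuChamp v₁ v₂ g g y := by
  rw [sdeGenerator_comp Y v₁ v₂ hF hF' hg y, carreDuChamp_self]

/-- Carré du champ of a composition: `Γ(F∘f, g) = F'(f) Γ(f, g)`. [folklore] -/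
theorem carreDuChamp_comp_left {F F' : ℝ → ℝ} (hF : ∀ u, HasDerivAt F (F' u) u) {f : E → ℝ}
    (hf : Differentiable ℝ f) (g : E → ℝ) (y : E) :
    carreDuChamp v₁ v₂ (fun y => F (f y)) g y = F' (f y) * carreDuChamp v₁ v₂ f g y := by
  simp only [carreDuChamp_def, fderiv_comp_eq_smul hF hf, smul_apply, smul_eq_mul]
  ring

/-- Carré du champ is additive in the first slot (for differentiable functions). [folklore] -/
theorem carreDuChamp_add_left {f₁ f₂ : E → ℝ} (h₁ : Differentiable ℝ f₁) (h₂ : Differentiable ℝ f₂)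
    (g : E → ℝ) (y : E) :
    carreDuChamp v₁ v₂ (fun y => f₁ y + f₂ y) g y = carreDuChamp v₁ v₂ f₁ g y + carreDuChamp v₁ v₂ f₂ g y := by
  simp only [carreDuChamp_def, fderiv_add (h₁ y) (h₂ y) |> fun h => show fderiv ℝ (fun y => f₁ y + f₂ y) y =
    fderiv ℝ f₁ y + fderiv ℝ f₂ y from h, add_apply]
  ring

/-- Carré du champ of a product in the first slot: `Γ(f₁f₂, g) = f₁ Γ(f₂,g) + f₂ Γ(f₁,g)`. [folklore] -/
theorem carreDuChamp_mul_left {f₁ f₂ : E → ℝ} (h₁ : Differentiable ℝ f₁) (h₂ : Differentiable ℝ f₂)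
    (g : E → ℝ) (y : E) :
    carreDuChamp v₁ v₂ (fun y => f₁ y * f₂ y) g y =
      f₁ y * carreDuChamp v₁ v₂ f₂ g y + f₂ y * carreDuChamp v₁ v₂ f₁ g y := by
  simp only [carreDuChamp_def, fderiv_mul (h₁ y) (h₂ y) |> fun h => show fderiv ℝ (fun y => f₁ y * f₂ y) y =
    f₁ y • fderiv ℝ f₂ y + f₂ y • fderiv ℝ f₁ y from h, add_apply, smul_apply, smul_eq_mul]
  ring

/-- Carré du champ with a constant multiple. [folklore] -/
theorem carreDuChamp_const_mul_left (c : ℝ) {f : E → ℝ} (hf : Differentiable ℝ f) (g : E → ℝ) (y : E) :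
    carreDuChamp v₁ v₂ (fun y => c * f y) g y = c * carreDuChamp v₁ v₂ f g y := by
  simp only [carreDuChamp_def, fderiv_const_mul (hf y) c, smul_apply, smul_eq_mul]
  ring

end Product

/-! ### Composition with a continuous linear map -/

section CompCLM

variable (Y : E → E) (v₁ v₂ : E)

/-- `D(g ∘ A) = (Dg ∘ A).comp A` for a continuous linear `A`. [folklore] -/
theorem fderiv_comp_clm_eq (A : E →L[ℝ] F) {g : F → ℝ} (hg : Differentiable ℝ g) :
    fderiv ℝ (fun y => g (A y)) = fun y => (fderiv ℝ g (A y)).comp A :=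
  funext fun y => ((hg (A y)).hasFDerivAt.comp y A.hasFDerivAt).fderiv

/-- `D²(g ∘ A)(y)[v, w] = D²g(Ay)[Av, Aw]`. [folklore] -/
theorem fderiv_fderiv_comp_clm_apply (A : E →L[ℝ] F) {g : F → ℝ} (hg : ContDiff ℝ 2 g) (y v w : E) :
    fderiv ℝ (fderiv ℝ (fun y => g (A y))) y v w = fderiv ℝ (fderiv ℝ g) (A y) (A v) (A w) := by
  have hgd : Differentiable ℝ g := hg.differentiable (by norm_num)
  have hgd2 : Differentiable ℝ (fderiv ℝ g) := (hg.fderiv_right (m := 1) (by norm_num)).differentiable (by norm_num)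
  rw [fderiv_comp_clm_eq A hgd]
  -- `y ↦ (Dg (A y)).comp A = P (Dg (A y))` with the continuous linear `P L = L.comp A`
  set P : (F →L[ℝ] ℝ) →L[ℝ] (E →L[ℝ] ℝ) := (ContinuousLinearMap.compL ℝ E F ℝ).flip A with hP
  have hP' : ∀ L : F →L[ℝ] ℝ, P L = L.comp A := fun L => by simp [hP]
  have h1 : (fun y => (fderiv ℝ g (A y)).comp A) = fun y => P (fderiv ℝ g (A y)) := funext fun y => (hP' _).symm
  rw [h1]
  have h2 : HasFDerivAt (fun y => P (fderiv ℝ g (A y))) (P.comp ((fderiv ℝ (fderiv ℝ g) (A y)).comp A)) y :=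
    P.hasFDerivAt.comp y ((hgd2 (A y)).hasFDerivAt.comp y A.hasFDerivAt)
  rw [h2.fderiv]
  simp [hP']

/-- **The generator of a composition with a continuous linear map**:
`L(g ∘ A)(y) = Dg(Ay)·A(Y y) + ½ (D²g(Ay)[Av₁,Av₁] + D²g(Ay)[Av₂,Av₂])`. [folklore] -/
theorem sdeGenerator_comp_clm (A : E →L[ℝ] F) {g : F → ℝ} (hg : ContDiff ℝ 2 g) (y : E) :
    sdeGenerator Y v₁ v₂ (fun y => g (A y)) y =
      fderiv ℝ g (A y) (A (Y y)) +
        (1 / 2) * (fderiv ℝ (fderiv ℝ g) (A y) (A v₁) (A v₁) + fderiv ℝ (fderiv ℝ g) (A y) (A v₂) (A v₂)) := by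
  rw [sdeGenerator_def, fderiv_fderiv_comp_clm_apply A hg, fderiv_fderiv_comp_clm_apply A hg,
    fderiv_comp_clm_eq A (hg.differentiable (by norm_num))]
  rfl

/-- When the linear map kills both noise vectors only the transport term survives:
`L(g ∘ A)(y) = Dg(Ay)·A(Y y)`. [folklore] -/
theorem sdeGenerator_comp_clm_of_apply_eq_zero (A : E →L[ℝ] F) {g : F → ℝ} (hg : ContDiff ℝ 2 g)
    (h₁ : A v₁ = 0) (h₂ : A v₂ = 0) (y : E) :
    sdeGenerator Y v₁ v₂ (fun y => g (A y)) y = fderiv ℝ g (A y) (A (Y y)) := by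
  rw [sdeGenerator_comp_clm Y v₁ v₂ A hg, h₁, h₂]
  simp

/-- The first derivative of `g ∘ A` along `v` vanishes when `A v = 0`. [folklore] -/
theorem fderiv_comp_clm_apply_eq_zero (A : E →L[ℝ] F) {g : F → ℝ} (hg : Differentiable ℝ g) {v : E}
    (hv : A v = 0) (y : E) : fderiv ℝ (fun y => g (A y)) y v = 0 := by
  rw [fderiv_comp_clm_eq A hg]
  simp [hv]

/-- `Γ(g ∘ A, f) = 0` when `A` kills both noise vectors. [folklore] -/
theorem carreDuChamp_comp_clm_eq_zero (A : E →L[ℝ] F) {g : F → ℝ} (hg : Differentiable ℝ g)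
    (h₁ : A v₁ = 0) (h₂ : A v₂ = 0) (f : E → ℝ) (y : E) :
    carreDuChamp v₁ v₂ (fun y => g (A y)) f y = 0 :=
  carreDuChamp_eq_zero_of_left v₁ v₂ (fderiv_comp_clm_apply_eq_zero A hg h₁ y)
    (fderiv_comp_clm_apply_eq_zero A hg h₂ y)

end CompCLM

end Literature.MathematicalPhysics.KineticTheory

end
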